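/-
Copyright (c) 2026 the pub-hodgecm-mathlib formalisation cell (harness21).  Prover seat hodgecm-mathlib-K2Liu-p11 (g5), Track B «K2-LIT»,
#184♮ = hLiu418 = `stmt-HodgeConjecture-24832`; socket #41 `sig_K2LiuSiegelEisensteinContinuation`, KIND W, brick (x-a-heb) part 2: THE FRAMED INDEX IS HERMITIAN for a
skew Fourier index in the closed-form Shimura frame of record (★ arch₄), and the character's frame reading `heb` with NO by-value letter — KW desk F0P2-p08 (g3)
2026-09-05T00:28:58Z (a); box K2Liu-audit1.  THEOREMS ONLY (no `def`, no `instance`, no notation, no named-fact hypothesis, no `sorry`, default heartbeats).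
-/
import Summits.HodgeConjecture.HodgeConjecture.Theorems.K2LiuKindWArchCharacterFrameReading   -- ★ (x-a-heb) part 1: `conj_unipDeltaChar_archToAdelic_eq_prod` (the reading modulo `hherm`)
import Summits.HodgeConjecture.HodgeConjecture.Theorems.K2LiuHermitianTubeFrameArch            -- ★ `tw_ne_zero`, `embedding_dVdW_eq_re`; brings Lit `gramR_eq_diagonal`, `embedding_galConj`
import HarnessLib

/-!
# Crux `HLiu418`, socket #41, KIND W — brick (x-a-heb) part 2 `K2LiuKindWArchFramedIndexHermitian`: `h_w(S) = −2·(T_w)₂₂·σ_w(S)·(T_w⁻¹)₁₁` IS HERMITIAN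
# for `S` skew w.r.t. `gramR` in the closed-form Shimura frame, and `heb` with NO by-value letter

Cell `hodgecm-mathlib`, crux item hLiu418 = `stmt-HodgeConjecture-24832` (helper lane `--supports … --as helper`, count-neutral), route of record
`HCCMUnconditional`; squad K2 ∕ K2Liu, road `K2_Liu`, socket #41, KIND W; KW desk of record F0P2-p08 (g3).
THE POINT.  ★ part 1 `K2LiuKindWArchCharacterFrameReading.conj_unipDeltaChar_archToAdelic_eq_prod` reads `conj ψ_S(ι_∞ a) = ∏_w e(−tr(h_w(S) · b_w))` with the framed
index `h_w(S) := −2·(T_w)₂₂·σ_w(S)·(T_w⁻¹)₁₁` BY VALUE hermitian (`hherm`).  In the CLOSED-FORM frame of record (★ arch₄ `exists_tubeFrame_arch₄` (x): `T_w = [[D,D],[C,−C]]`,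
`T_w⁻¹ = ½[[D⁻¹,C⁻¹],[D⁻¹,−C⁻¹]]`, `D = diag(√(|t_k|∕2))`, `C = diag(i·sgn(t_k)·√(|t_k|∕2))`, `t_k = σ_w(dV_{(e⁻¹k).1} dW_{(e⁻¹k).2}) ∈ ℝ^×` — ★ `tw_ne_zero`, ★
`embedding_dVdW_eq_re`) one has `(T_w)₂₂ = −C`, `(T_w⁻¹)₁₁ = ½D⁻¹`, so `h_w(S)_{ij} = i·sgn(t_i)·√(|t_i|∕|t_j|)·σ_w(S)_{ij}`; and for `S` SKEW w.r.t. the real diagonal Gram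
matrix `G = gramR ⊗ L` (★ `skewMatrices`: `G S + (c S)ᵀ G = 0`; Lit `gramR_eq_diagonal`; at the place: `t_i σ_w(S)_{ij} + conj(σ_w(S)_{ji}) t_j = 0`, Lit `embedding_galConj`)
this matrix IS HERMITIAN (§1, an entrywise identity in `√`, `|·|`, `sgn`).  §2 packages part 1 with §1: **`heb` for skew indices in the closed-form frame, NO by-value
letter** — the shape the ∃-frame head ★ `K2LiuKindWArchContinuationFramesOfRecord.exists_frames_hex_of_std` (LH4-p10) consumes (`eb S h w b := e(−tr(h_w(↑S)·b))`).
[Shimura1997, §18.1 (18.4), §A3] [CasselsFrohlichANT1967, Ch. XV (Tate) §4.1] [GelbartRogawski1991, §3.1 Prop. 3.1.1] [MoeglinWaldspurger1995, II.1.5].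
HONEST LABEL.  Count-neutral helper; closes no socket by itself: `HC_CM` is proved only modulo the 7 printed citations (2 remaining named inputs:
hLiu418 = `stmt-HodgeConjecture-24832`, h413 = `stmt-HodgeConjecture-24833`) until rung 0 closes.  NOT HERE: the SIGNATURE (definite ∕ indefinite) of `h_w(S)` — the per-place
Whittaker payers' `hidx.PosDef` ∕ «Φ6b-ind» split.

## References
* [Shimura1997] G. Shimura, *Euler Products and Eisenstein Series*, CBMS 93 (1997), §18.1 (18.4), §A3 (the index `h` of `e(tr(h b))` in the tube coordinates).
* [CasselsFrohlichANT1967] J. Tate, in Cassels–Fröhlich, *Algebraic Number Theory* (1967), Ch. XV §4.1 (the global additive character).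
* [GelbartRogawski1991] S. Gelbart, J. Rogawski, *L-functions and Fourier–Jacobi coefficients for the unitary group U(3)*, Invent. Math. 105 (1991), §3.1 Prop. 3.1.1 (the
  doubled hermitian space and its diagonal Gram data).
* [MoeglinWaldspurger1995] C. Mœglin, J.-L. Waldspurger, *Spectral Decomposition and Eisenstein Series* (1995), II.1.5.
-/

set_option autoImplicit false
set_option linter.dupNamespace false -- the mandated namespace repeats `HodgeConjecture.HodgeConjecture`

noncomputable section

open scoped Matrix ComplexConjugate Classical
open Complex Matrix NumberField NumberField.InfinitePlace IsDedekindDomain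
open Literature.NumberTheory.Automorphic Literature.NumberTheory.Automorphic.UnitaryGroup Literature.NumberTheory.GaloisRepresentations
open Literature.NumberTheory.GelbartRogawski1991 Literature.NumberTheory.GelbartRogawski1991.GRConstruction
open Literature.NumberTheory.GelbartRogawski1991.UnitaryDualPair
open Literature.NumberTheory.K2Lit.SiegelDoubled

namespace Summit.HodgeConjecture.HodgeConjecture.Cruxes.HLiu418.K2LiuKindWArchFramedIndexHermitian

open K2LiuSiegelUnipotentLocalDefs
open K2LiuSiegelUnipotentFourierDefs (skewMatrices unipDeltaChar mem_skewMatrices_iff)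
open K2LiuHermitianTubeFrameArch (tw_ne_zero embedding_dVdW_eq_re)
open K2LiuKindWArchCharacterFrameReading (conj_unipDeltaChar_archToAdelic_eq_prod)

variable (L : Type) [Field L] [NumberField L] [IsCMField L] {N M n : ℕ} (e : Fin N × Fin M ≃ Fin n)
  (dV : Fin N → L) (hdV : ∀ i, IsCMField.complexConj L (dV i) = dV i)
  (dW : Fin M → L) (hdW : ∀ i, IsCMField.complexConj L (dW i) = dW i)

/-! ## §1 The framed index of a skew Fourier index is hermitian -/

section Hermitian

/-- the real algebra of the Shimura frame entries: with `d = √(|t|∕2)` and `t ≠ 0`, `(t∕|t|)·d = t·(d⁻¹∕2)` (both are `t∕(2d)`, since `|t| = 2d²`). [folklore] -/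
theorem shimura_entry_eq {t : ℝ} (ht : t ≠ 0) : t / |t| * Real.sqrt (|t| / 2) = t * ((Real.sqrt (|t| / 2))⁻¹ / 2) := by
  have hta : 0 < |t| := abs_pos.2 ht
  set d := Real.sqrt (|t| / 2) with hd
  have hd0 : 0 < d := Real.sqrt_pos.2 (by positivity)
  have hd2 : d * d = |t| / 2 := Real.mul_self_sqrt (by positivity)
  have habs : |t| = 2 * (d * d) := by linarith
  rw [habs]
  field_simp

variable (w : {w : InfinitePlace L // w.IsComplex})

include hdV hdW in
/-- **the skew relation at a complex place**: for `S ∈ Skew_{gramR}(L)` (`G S + (c S)ᵀ G = 0`), entrywise at `w`: `t_i · σ_w(S)_{ij} + conj(σ_w(S)_{ji}) · t_j = 0`,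
`t_k = σ_w(dV dW)_k ∈ ℝ` (Lit `gramR_eq_diagonal`, ★ `embedding_dVdW_eq_re`, Lit `embedding_galConj`). [cite: Shimura1997, §18.1] [cite: GelbartRogawski1991, §3.1 Prop. 3.1.1] -/
theorem skew_relation_at_place (S : Matrix (Fin n) (Fin n) L)
    (hS : S ∈ skewMatrices ((IsCMField.complexConj L : L ≃ₐ[Fp L] L) : L →+* L) ((gramR L e dV hdV dW hdW).map (algebraMap (Fp L) L))) (i j : Fin n) :
    (((w.1.embedding (dV (e.symm i).1 * dW (e.symm i).2)).re : ℝ) : ℂ) * S.map w.1.embedding i j +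
      conj (S.map w.1.embedding j i) * (((w.1.embedding (dV (e.symm j).1 * dW (e.symm j).2)).re : ℝ) : ℂ) = 0 := by
  have hw : IsCMField.complexConj L • w.1 = w.1 := UnitaryGroup.complexConj_smul_infinitePlace L w.1
  rw [mem_skewMatrices_iff, gramR_eq_diagonal, Matrix.diagonal_map (map_zero _)] at hS
  have h := congr_arg (fun X : Matrix (Fin n) (Fin n) L => w.1.embedding (X i j)) hS
  simp only [Matrix.add_apply, Matrix.diagonal_mul, Matrix.mul_diagonal, Matrix.transpose_apply, Matrix.map_apply, Matrix.zero_apply, map_add, map_mul,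
    map_zero] at h
  rw [← embedding_dVdW_eq_re L e dV hdV dW hdW w hw i, ← embedding_dVdW_eq_re L e dV hdV dW hdW w hw j]
  have hc : w.1.embedding (((IsCMField.complexConj L : L ≃ₐ[Fp L] L) : L →+* L) (S j i)) = conj (w.1.embedding (S j i)) :=
    embedding_galConj (Fp L) L (IsCMField.complexConj L) w hw (IsCMField.complexConj_ne_one L) (S j i)
  have hi : w.1.embedding (algebraMap (Fp L) L ⟨dV (e.symm i).1, (IsCMField.complexConj_eq_self_iff (K := L) (dV (e.symm i).1)).1 (hdV _)⟩) *
      w.1.embedding (algebraMap (Fp L) L ⟨dW (e.symm i).2, (IsCMField.complexConj_eq_self_iff (K := L) (dW (e.symm i).2)).1 (hdW _)⟩) =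
      w.1.embedding (dV (e.symm i).1 * dW (e.symm i).2) := by
    rw [← map_mul]; rfl
  have hj : w.1.embedding (algebraMap (Fp L) L ⟨dV (e.symm j).1, (IsCMField.complexConj_eq_self_iff (K := L) (dV (e.symm j).1)).1 (hdV _)⟩) *
      w.1.embedding (algebraMap (Fp L) L ⟨dW (e.symm j).2, (IsCMField.complexConj_eq_self_iff (K := L) (dW (e.symm j).2)).1 (hdW _)⟩) =
      w.1.embedding (dV (e.symm j).1 * dW (e.symm j).2) := by
    rw [← map_mul]; rfl
  rw [hi, hj, hc] at h
  simpa only [Matrix.map_apply] using h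

include hdV hdW in
/-- **THE FRAMED INDEX IS HERMITIAN.**  In the closed-form Shimura frame at `w` (`(T_w)₂₂ = −diag(i·sgn(t_k)·√(|t_k|∕2))`, `(T_w⁻¹)₁₁ = diag(√(|t_k|∕2)⁻¹∕2)`), for `S` skew
w.r.t. `gramR`: `(−2 · (T_w)₂₂ · σ_w(S) · (T_w⁻¹)₁₁)ᴴ = −2 · (T_w)₂₂ · σ_w(S) · (T_w⁻¹)₁₁` (entrywise: `skew_relation_at_place` + `shimura_entry_eq`, ★ `tw_ne_zero`).
[cite: Shimura1997, §18.1 (18.4), §A3] [cite: GelbartRogawski1991, §3.1 Prop. 3.1.1] -/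
theorem framedIndex_conjTranspose (hdV0 : ∀ i, dV i ≠ 0) (hdW0 : ∀ j, dW j ≠ 0) (S : Matrix (Fin n) (Fin n) L)
    (hS : S ∈ skewMatrices ((IsCMField.complexConj L : L ≃ₐ[Fp L] L) : L →+* L) ((gramR L e dV hdV dW hdW).map (algebraMap (Fp L) L))) :
    ((-2 : ℂ) • ((-diagonal (fun k => I * ((((w.1.embedding (dV (e.symm k).1 * dW (e.symm k).2)).re / |(w.1.embedding (dV (e.symm k).1 * dW (e.symm k).2)).re|) *
        Real.sqrt (|(w.1.embedding (dV (e.symm k).1 * dW (e.symm k).2)).re| / 2) : ℝ) : ℂ))) * S.map w.1.embedding *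
        diagonal (fun k => (((Real.sqrt (|(w.1.embedding (dV (e.symm k).1 * dW (e.symm k).2)).re| / 2))⁻¹ / 2 : ℝ) : ℂ))))ᴴ =
      (-2 : ℂ) • ((-diagonal (fun k => I * ((((w.1.embedding (dV (e.symm k).1 * dW (e.symm k).2)).re / |(w.1.embedding (dV (e.symm k).1 * dW (e.symm k).2)).re|) *
        Real.sqrt (|(w.1.embedding (dV (e.symm k).1 * dW (e.symm k).2)).re| / 2) : ℝ) : ℂ))) * S.map w.1.embedding *
        diagonal (fun k => (((Real.sqrt (|(w.1.embedding (dV (e.symm k).1 * dW (e.symm k).2)).re| / 2))⁻¹ / 2 : ℝ) : ℂ))) := by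
  have hw : IsCMField.complexConj L • w.1 = w.1 := UnitaryGroup.complexConj_smul_infinitePlace L w.1
  have ht0 : ∀ k : Fin n, (w.1.embedding (dV (e.symm k).1 * dW (e.symm k).2)).re ≠ 0 := tw_ne_zero L e dV hdV dW hdW w hw hdV0 hdW0
  ext i j
  have hsk := skew_relation_at_place L e dV hdV dW hdW w S hS i j
  simp only [Matrix.conjTranspose_apply, Matrix.smul_apply, Matrix.neg_mul, Matrix.neg_apply, Matrix.mul_diagonal, Matrix.diagonal_mul, smul_eq_mul]
  -- freeze the two real parameters `t_i`, `t_j` (so that no ring-hom rewriting enters them)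
  set ti : ℝ := (w.1.embedding (dV (e.symm i).1 * dW (e.symm i).2)).re with hti
  set tj : ℝ := (w.1.embedding (dV (e.symm j).1 * dW (e.symm j).2)).re with htj
  have hti0 : ti ≠ 0 := ht0 i
  have htj0 : tj ≠ 0 := ht0 j
  have htjC : ((tj : ℝ) : ℂ) ≠ 0 := by exact_mod_cast htj0
  -- the Shimura entries `a_k = (t_k∕|t_k|)√(|t_k|∕2) = t_k · (√(|t_k|∕2)⁻¹∕2) = t_k · b_k`
  rw [shimura_entry_eq hti0, shimura_entry_eq htj0]
  simp only [star_mul', star_neg, Complex.star_def, Complex.conj_ofReal, Complex.conj_I, map_ofNat]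
  -- the skew relation solves `conj(σS_ji)`
  have hconj : conj (S.map w.1.embedding j i) = -((ti : ℝ) : ℂ) * S.map w.1.embedding i j / ((tj : ℝ) : ℂ) := by
    field_simp
    linear_combination hsk
  rw [hconj]
  push_cast
  field_simp

include hdV hdW in
/-- **THE FRAMED INDEX OF A NON-SINGULAR INDEX IS NON-SINGULAR**: `det S ≠ 0 ⇒ det h_w(S) ≠ 0` (`det` of a scalar multiple of `diag · σ_w(S) · diag` with non-zero diagonal
entries; `σ_w` is injective). The guard of record `det ↑S ≠ 0` of the per-place dispatch. [cite: Shimura1997, §18.1 (18.4)] -/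
theorem framedIndex_det_ne_zero (hdV0 : ∀ i, dV i ≠ 0) (hdW0 : ∀ j, dW j ≠ 0) (S : Matrix (Fin n) (Fin n) L) (hS : S.det ≠ 0) :
    ((-2 : ℂ) • ((-diagonal (fun k => I * ((((w.1.embedding (dV (e.symm k).1 * dW (e.symm k).2)).re / |(w.1.embedding (dV (e.symm k).1 * dW (e.symm k).2)).re|) *
        Real.sqrt (|(w.1.embedding (dV (e.symm k).1 * dW (e.symm k).2)).re| / 2) : ℝ) : ℂ))) * S.map w.1.embedding *
        diagonal (fun k => (((Real.sqrt (|(w.1.embedding (dV (e.symm k).1 * dW (e.symm k).2)).re| / 2))⁻¹ / 2 : ℝ) : ℂ)))).det ≠ 0 := by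
  have hw : IsCMField.complexConj L • w.1 = w.1 := UnitaryGroup.complexConj_smul_infinitePlace L w.1
  have ht0 : ∀ k : Fin n, (w.1.embedding (dV (e.symm k).1 * dW (e.symm k).2)).re ≠ 0 := tw_ne_zero L e dV hdV dW hdW w hw hdV0 hdW0
  have hd : ∀ k : Fin n, Real.sqrt (|(w.1.embedding (dV (e.symm k).1 * dW (e.symm k).2)).re| / 2) ≠ 0 := fun k => by
    have hk : 0 < |(w.1.embedding (dV (e.symm k).1 * dW (e.symm k).2)).re| := abs_pos.2 (ht0 k)
    exact (Real.sqrt_pos.2 (by positivity)).ne'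
  rw [Matrix.det_smul, Matrix.det_mul, Matrix.det_mul, Matrix.det_neg, Matrix.det_diagonal, Matrix.det_diagonal]
  refine mul_ne_zero (pow_ne_zero _ (by norm_num)) (mul_ne_zero (mul_ne_zero (mul_ne_zero (pow_ne_zero _ (by norm_num)) ?_) ?_) ?_)
  · exact Finset.prod_ne_zero_iff.2 fun k _ => mul_ne_zero I_ne_zero (by exact_mod_cast mul_ne_zero (div_ne_zero (ht0 k) (abs_ne_zero.2 (ht0 k))) (hd k))
  · rw [← RingHom.mapMatrix_apply, ← RingHom.map_det]
    exact (map_ne_zero _).2 hS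
  · exact Finset.prod_ne_zero_iff.2 fun k _ => by exact_mod_cast div_ne_zero (inv_ne_zero (hd k)) two_ne_zero

end Hermitian

/-! ## §2 `heb` for skew indices in the closed-form frame — no by-value letter -/

section Heb

variable (T Tinv : {w : InfinitePlace L // w.IsComplex} → Matrix (Fin n ⊕ Fin n) (Fin n ⊕ Fin n) ℂ)
  (Fr : UnitaryGroup.arch (Fp L) L (IsCMField.complexConj L) (n + n) (hermD L e dV hdV dW hdW) →
    {w : InfinitePlace L // w.IsComplex} → Matrix (Fin n ⊕ Fin n) (Fin n ⊕ Fin n) ℂ)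
  (hFr : ∀ a w, Fr a w = T w * Matrix.reindex (e₂ (n := n)).symm (e₂ (n := n)).symm
    (((UnitaryGroup.archAt (Fp L) L (IsCMField.complexConj L) (n + n) (hermD L e dV hdV dW hdW) w
      (UnitaryGroup.complexConj_smul_infinitePlace L w.1) (IsCMField.complexConj_ne_one L) a :
        UnitaryGroup.archLocal L (n + n) (hermD L e dV hdV dW hdW) w) : GL (Fin (n + n)) ℂ) : Matrix (Fin (n + n)) (Fin (n + n)) ℂ) * Tinv w)
  (hT2 : ∀ w, Tinv w * T w = 1)
  (hTiv : ∀ w (u : GL (Fin (n + n)) ℂ), u ∈ UnitaryGroup.archLocal L (n + n) (hermD L e dV hdV dW hdW) w →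
    IsUnipM (n := n) (u : Matrix (Fin (n + n)) (Fin (n + n)) ℂ) →
      ∃ b : Matrix (Fin n) (Fin n) ℂ, bᴴ = b ∧ T w * Matrix.reindex (e₂ (n := n)).symm (e₂ (n := n)).symm (u : Matrix _ _ ℂ) * Tinv w = fromBlocks 1 b 0 1)
  (hTdef : ∀ w, T w = fromBlocks (diagonal (fun k => (Real.sqrt (|(w.1.embedding (dV (e.symm k).1 * dW (e.symm k).2)).re| / 2) : ℂ))) (diagonal (fun k => (Real.sqrt (|(w.1.embedding (dV (e.symm k).1 * dW (e.symm k).2)).re| / 2) : ℂ)))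
    (diagonal (fun k => I * ((((w.1.embedding (dV (e.symm k).1 * dW (e.symm k).2)).re / |(w.1.embedding (dV (e.symm k).1 * dW (e.symm k).2)).re|) * Real.sqrt (|(w.1.embedding (dV (e.symm k).1 * dW (e.symm k).2)).re| / 2) : ℝ) : ℂ))) (-diagonal (fun k => I * ((((w.1.embedding (dV (e.symm k).1 * dW (e.symm k).2)).re / |(w.1.embedding (dV (e.symm k).1 * dW (e.symm k).2)).re|) * Real.sqrt (|(w.1.embedding (dV (e.symm k).1 * dW (e.symm k).2)).re| / 2) : ℝ) : ℂ))))
  (hTinvdef : ∀ w, Tinv w = fromBlocks (diagonal (fun k => (((Real.sqrt (|(w.1.embedding (dV (e.symm k).1 * dW (e.symm k).2)).re| / 2))⁻¹ / 2 : ℝ) : ℂ))) (-diagonal (fun k => I * (((Real.sqrt (|(w.1.embedding (dV (e.symm k).1 * dW (e.symm k).2)).re| / 2))⁻¹ * ((w.1.embedding (dV (e.symm k).1 * dW (e.symm k).2)).re / |(w.1.embedding (dV (e.symm k).1 * dW (e.symm k).2)).re|) / 2 : ℝ) : ℂ)))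
    (diagonal (fun k => (((Real.sqrt (|(w.1.embedding (dV (e.symm k).1 * dW (e.symm k).2)).re| / 2))⁻¹ / 2 : ℝ) : ℂ))) (diagonal (fun k => I * (((Real.sqrt (|(w.1.embedding (dV (e.symm k).1 * dW (e.symm k).2)).re| / 2))⁻¹ * ((w.1.embedding (dV (e.symm k).1 * dW (e.symm k).2)).re / |(w.1.embedding (dV (e.symm k).1 * dW (e.symm k).2)).re|) / 2 : ℝ) : ℂ))))

include hdV hdW hTdef hTinvdef in
/-- in the closed-form frame the framed index of a skew index is hermitian (§1 read on the blocks `(T_w)₂₂`, `(T_w⁻¹)₁₁`). [cite: Shimura1997, §18.1 (18.4)] -/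
theorem framedIndex_conjTranspose_of_frame (hdV0 : ∀ i, dV i ≠ 0) (hdW0 : ∀ j, dW j ≠ 0) (S : Matrix (Fin n) (Fin n) L)
    (hS : S ∈ skewMatrices ((IsCMField.complexConj L : L ≃ₐ[Fp L] L) : L →+* L) ((gramR L e dV hdV dW hdW).map (algebraMap (Fp L) L)))
    (w : {w : InfinitePlace L // w.IsComplex}) :
    ((-2 : ℂ) • ((T w).toBlocks₂₂ * S.map w.1.embedding * (Tinv w).toBlocks₁₁))ᴴ = (-2 : ℂ) • ((T w).toBlocks₂₂ * S.map w.1.embedding * (Tinv w).toBlocks₁₁) := by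
  rw [hTdef w, hTinvdef w, Matrix.toBlocks_fromBlocks₂₂, Matrix.toBlocks_fromBlocks₁₁]
  exact framedIndex_conjTranspose L e dV hdV dW hdW w hdV0 hdW0 S hS

include hdV hdW hTdef hTinvdef in
/-- in the closed-form frame the framed index of a non-singular index is non-singular (§1 `framedIndex_det_ne_zero` read on the blocks). [cite: Shimura1997, §18.1 (18.4)] -/
theorem framedIndex_det_ne_zero_of_frame (hdV0 : ∀ i, dV i ≠ 0) (hdW0 : ∀ j, dW j ≠ 0) (S : Matrix (Fin n) (Fin n) L) (hS : S.det ≠ 0)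
    (w : {w : InfinitePlace L // w.IsComplex}) :
    ((-2 : ℂ) • ((T w).toBlocks₂₂ * S.map w.1.embedding * (Tinv w).toBlocks₁₁)).det ≠ 0 := by
  rw [hTdef w, hTinvdef w, Matrix.toBlocks_fromBlocks₂₂, Matrix.toBlocks_fromBlocks₁₁]
  exact framedIndex_det_ne_zero L e dV hdV dW hdW w hdV0 hdW0 S hS

include hdV hdW hFr hT2 hTiv hTdef hTinvdef in
/-- **`heb` WITH NO BY-VALUE LETTER.**  In the closed-form Shimura frame of record (★ arch₄ letters `hTdef hTinvdef` + `hFr hT2 hTiv`, BY VALUE — exactly the conjuncts exported by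
★ `K2LiuKindWArchContinuationFramesOfRecord.exists_frames_hex_of_std`), for EVERY skew index `S` and every `a ∈ N_Δ(L⁺ ⊗ ℝ)`:
`conj (unipDeltaChar ↑S (archToAdelic ↑a)) = ∏ w, cexp (−(2πI) · tr(h_w(↑S) · (Fr ↑a w)₁₂))`, `h_w(S) = −2·(T_w)₂₂·σ_w(S)·(T_w⁻¹)₁₁` — ★ part 1 §5 with `hherm` DISCHARGED by §1.  At the
∃-frame head: `eb := fun S _ w b => cexp (-(2 * Real.pi * I) * (((-2 : ℂ) • ((T w).toBlocks₂₂ * (↑S).map w.1.embedding * (Tinv w).toBlocks₁₁)) * b).trace)`, `heb := heb_of_skew …`.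
[cite: Shimura1997, §18.1 (18.4), §A3] [cite: CasselsFrohlichANT1967, Ch. XV (Tate) §4.1] [cite: MoeglinWaldspurger1995, II.1.5] -/
theorem heb_of_skew (hdV0 : ∀ i, dV i ≠ 0) (hdW0 : ∀ j, dW j ≠ 0)
    (S : skewMatrices ((IsCMField.complexConj L : L ≃ₐ[Fp L] L) : L →+* L) ((gramR L e dV hdV dW hdW).map (algebraMap (Fp L) L)))
    (a : ↥(unipDeltaArch L e dV hdV dW hdW)) :
    conj (unipDeltaChar L e dV hdV dW hdW (S : Matrix (Fin n) (Fin n) L)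
        (UnitaryGroup.archToAdelic (Fp L) L (IsCMField.complexConj L) (n + n) (hermD L e dV hdV dW hdW)
          (a : UnitaryGroup.arch (Fp L) L (IsCMField.complexConj L) (n + n) (hermD L e dV hdV dW hdW))) : ℂ) =
      ∏ w : {w : InfinitePlace L // w.IsComplex},
        cexp (-(2 * Real.pi * I) * (((-2 : ℂ) • ((T w).toBlocks₂₂ * (S : Matrix (Fin n) (Fin n) L).map w.1.embedding * (Tinv w).toBlocks₁₁)) *
          (Fr (a : UnitaryGroup.arch (Fp L) L (IsCMField.complexConj L) (n + n) (hermD L e dV hdV dW hdW)) w).toBlocks₁₂).trace) :=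
  conj_unipDeltaChar_archToAdelic_eq_prod L e dV hdV dW hdW T Tinv Fr hFr hT2 hTiv (S : Matrix (Fin n) (Fin n) L) _ (fun _ => rfl)
    (fun w => framedIndex_conjTranspose_of_frame L e dV hdV dW hdW T Tinv hTdef hTinvdef hdV0 hdW0 (S : Matrix (Fin n) (Fin n) L) S.2 w) a

end Heb

end Summit.HodgeConjecture.HodgeConjecture.Cruxes.HLiu418.K2LiuKindWArchFramedIndexHermitian

end
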